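import Summits.BirchSwinnertonDyer.BirchSwinnertonDyer.Theorems.ManinLocalTwoThreeTameThreeSubgroupLaws
import Mathlib.NumberTheory.Padics.Hensel
import HarnessLib

/-!
# The local `3`-lines of a Kodaira type `III` curve at `3` (`9 ∥ N`, `v₃ Δ_min = 3`): E-imc-77 (the canonical line has
# UNRAMIFIED character) and E-imc-76 (a `ℚ₃`-line exists iff the curve is SHALLOW, `9 ∤ b₂ − 12b₆`) — PROVED

Summit `BirchSwinnertonDyer`, route `ManinLocalTwoThree` (cell bsd-f2-manin), crux C3 `ManinPrimeToThreeAtNine`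
(stmt-BirchSwinnertonDyer-22968), the (OTA₃) analysis of the `W[3]`-reducible / locally reducible type-`III` residual
(imc g14, MEMO-imc §19.11, §20.4; rows E-imc-76 `TameThreeIIIShallowIffLocalLine`, E-imc-77
`TameThreeIIICanonicalLineUnramified` of HOME/imc/Sketch-imc-g14.lean :184–208, census g14-psi3.out: shallow 38 145 ⇒ one
`ℚ₃`-root, deep 17 577 ⇒ none, `v₃(D₀)` even 38 145 / 38 145).  The rows are NOT yet typed in the tree; they are landed
here as DATUM-FREE theorems over `W.conductorNorm ℤ` (refuter-1 T-54a: the sketch's `(_D : ModularParametrizationData W N)`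
binder pins `N` to the conductor only through Carayol), with imc's `DeepIII W` unfolded to
`W.b₂ − 12 W.b₆ = 0 ∨ 2 ≤ v₃(W.b₂ − 12 W.b₆)`; a later typed row closes by `Iff.rfl`-level glue.

Tools: this seat's Newton-polygon core for `F = 3z⁴ + 3βz³ + 9γz² + 27δz + 9ε` (`3 ∤ ε`) on the integer `III`-shape
translate (`Theorems/ManinLocalTwoThreeTypeThreePsiThreeNewtonPolygon.lean`, p624322): every `ℚ₃`-root is a unit
`≡ −β (mod 3)`, its discriminant `4z³ + 3βz² + 6γz + 9δ` is a unit; plus, new here, Hensel's lemma (Mathlib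
`hensels_lemma` over `ℤ`): for `3 ∤ β` the simple root `−β` of `z⁴ + βz³ (mod 3)` lifts
(`exists_psi3III_root_of_not_three_dvd`), and `not_three_dvd_of_psi3III_root` (a unit root forces `3 ∤ β`).

* `tameThreeIII_norm_localDisc_eq_one` — at a `ℚ₃`-root `x` of `Ψ₃`: `|4x³ + b₂x² + 2b₄x + b₆|₃ = 1`;
* **`tameThreeIII_canonicalLine_unramified`** (E-imc-77, datum-free): `D₀ ≠ 0 ∧ Even (Padic.valuation D₀)` (indeed `0`);
* **`tameThreeIII_localLine_iff_shallow`** (E-imc-76, datum-free): `¬ NoLocalThreeLineAtThree W ↔ ¬ DeepIII` —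
  `b₂ − 12b₆ ≡ 3β (mod 9)` on the translate (`r³ ≡ r (mod 3)`).

No new definitions, no named fact, no sorry.  HONEST FRAMING: local lemmas at `3`; nothing about BSD or Manin's
conjecture is proved here; C3 remains open.

References: J. H. Silverman, *ATAEC* IV.9.4 Steps 2–4 and Table 4.1 [cite: SilvermanATAEC1994, IV.9.4 and Table 4.1];
N. Katz, *p-adic properties of modular schemes and modular forms* (LNM 350), §3 (canonical subgroup; the prediction D6 of
MEMO-imc §20); cell memos HOME/MEMO-imc.md §19.11, §20.4; refuter-1 §R54.
-/

set_option linter.dupNamespace false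

noncomputable section

open scoped Classical

open WeierstrassCurve Summit.BirchSwinnertonDyer.Rank1Residual.ManinAdditive.TameThreeCharacter

namespace Summit.BirchSwinnertonDyer.BirchSwinnertonDyer.Theorems.ManinLocalTwoThree

section Local

variable {β γ δ ε : ℤ}

/-- Numerals pass through the coercion `ℤ₃ → ℚ₃`. -/
private theorem coe_ofNat_three' (n : ℕ) [n.AtLeastTwo] :
    ((ofNat(n) : ℤ_[3]) : ℚ_[3]) = ofNat(n) := rfl

/-- In `ℤ₃`, an element with non-zero reduction mod `3` is a unit. -/
private theorem isUnit_of_toZMod_ne_zero' {a : ℤ_[3]} (h : PadicInt.toZMod a ≠ 0) : IsUnit a := by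
  by_contra hu
  have hmem : a ∈ IsLocalRing.maximalIdeal ℤ_[3] := hu
  rw [← PadicInt.ker_toZMod, RingHom.mem_ker] at hmem
  exact h hmem

/-- For an integer `n`: `3 ∣ (n : ℤ₃)` iff `3 ∣ n`. -/
private theorem three_dvd_intCast_iff' (n : ℤ) : (3 : ℤ_[3]) ∣ (n : ℤ_[3]) ↔ (3 : ℤ) ∣ n := by
  have h := PadicInt.pow_p_dvd_int_iff (p := 3) 1 n
  simp only [pow_one, Nat.cast_ofNat] at h
  exact_mod_cast h

/-- **Shallow ⇒ `3 ∤ β`**: a unit root `z` of `3z⁴ + 3βz³ + 9γz² + 27δz + 9ε` forces `3 ∤ β`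
(`z ≡ −β (mod 3)` by `three_dvd_add_of_psi3III_root`). -/
theorem not_three_dvd_of_psi3III_root {z : ℤ_[3]} (hu : IsUnit z)
    (hz : 3 * z ^ 4 + 3 * (β : ℤ_[3]) * z ^ 3 + 9 * (γ : ℤ_[3]) * z ^ 2 + 27 * (δ : ℤ_[3]) * z
      + 9 * (ε : ℤ_[3]) = 0) : ¬ (3 : ℤ) ∣ β := by
  intro hβ
  obtain ⟨t, ht⟩ := three_dvd_add_of_psi3III_root hu hz
  obtain ⟨b, hb⟩ := (three_dvd_intCast_iff' β).mpr hβ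
  have h3z : (3 : ℤ_[3]) ∣ z := ⟨t - b, by linear_combination ht - hb⟩
  have hlt : ‖z‖ < 1 := by
    have := (PadicInt.norm_lt_one_iff_dvd z).mpr (by simpa only [Nat.cast_ofNat] using h3z)
    exact this
  exact absurd (PadicInt.isUnit_iff.mp hu) (ne_of_lt hlt)

/-- **`3 ∤ β` ⇒ a unit root (Hensel)**: `z⁴ + βz³ + 3γz² + 9δz + 3ε` has the simple root `−β` mod `3`, which lifts
to `ℤ₃`. [cite: SilvermanATAEC1994, IV.9.4 Step 4 (type III)] -/
theorem exists_psi3III_root_of_not_three_dvd (hβ : ¬ (3 : ℤ) ∣ β) :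
    ∃ z : ℤ_[3], 3 * z ^ 4 + 3 * (β : ℤ_[3]) * z ^ 3 + 9 * (γ : ℤ_[3]) * z ^ 2 + 27 * (δ : ℤ_[3]) * z
      + 9 * (ε : ℤ_[3]) = 0 := by
  set F : Polynomial ℤ := Polynomial.X ^ 4 + Polynomial.C β * Polynomial.X ^ 3 +
    Polynomial.C (3 * γ) * Polynomial.X ^ 2 + Polynomial.C (9 * δ) * Polynomial.X + Polynomial.C (3 * ε) with hF
  have hFeval : ∀ a : ℤ_[3], F.aeval a = a ^ 4 + β * a ^ 3 + 3 * γ * a ^ 2 + 9 * δ * a + 3 * ε := by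
    intro a
    simp only [hF, map_add, map_mul, map_pow, map_ofNat, map_intCast, Polynomial.aeval_X, eq_intCast]
  have hF'eval : ∀ a : ℤ_[3], F.derivative.aeval a = 4 * a ^ 3 + 3 * β * a ^ 2 + 6 * γ * a + 9 * δ := by
    intro a
    have hd : F.derivative = Polynomial.C (4 : ℤ) * Polynomial.X ^ 3 + Polynomial.C β * (Polynomial.C (3 : ℤ) *
        Polynomial.X ^ 2) + Polynomial.C (3 * γ) * (Polynomial.C (2 : ℤ) * Polynomial.X ^ 1) +
        Polynomial.C (9 * δ) := by
      rw [hF]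
      simp only [Polynomial.derivative_add, Polynomial.derivative_X_pow,
        Polynomial.derivative_mul, Polynomial.derivative_C, Polynomial.derivative_X, zero_mul, zero_add, mul_one,
        add_zero]
      norm_num
    rw [hd]
    simp only [map_add, map_mul, map_pow, map_ofNat, map_intCast, Polynomial.aeval_X, eq_intCast]
    ring
  set a : ℤ_[3] := -(β : ℤ_[3]) with ha
  -- `F(a) = 3(γβ² − 3δβ + ε)` has norm `< 1`
  have hFa : ‖F.aeval a‖ < 1 := by
    rw [hFeval, ha, ← PadicInt.mem_nonunits, ← IsLocalRing.mem_maximalIdeal, PadicInt.maximalIdeal_eq_span_p,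
      Ideal.mem_span_singleton]
    exact ⟨γ * β ^ 2 - 3 * δ * β + ε, by push_cast; ring⟩
  -- `F'(a) = −β³ − 6γβ + 9δ` is a unit
  have hF'a : ‖F.derivative.aeval a‖ = 1 := by
    rw [hF'eval]
    apply PadicInt.isUnit_iff.mp
    apply isUnit_of_toZMod_ne_zero'
    have hb : PadicInt.toZMod (β : ℤ_[3]) ≠ 0 := by
      intro h0
      apply hβ
      rw [← three_dvd_intCast_iff']
      have hmem : (β : ℤ_[3]) ∈ RingHom.ker (PadicInt.toZMod (p := 3)) := h0
      rw [PadicInt.ker_toZMod, PadicInt.maximalIdeal_eq_span_p, Ideal.mem_span_singleton] at hmem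
      simpa only [Nat.cast_ofNat] using hmem
    have e : (4 * a ^ 3 + 3 * β * a ^ 2 + 6 * γ * a + 9 * δ : ℤ_[3]) =
        -(β : ℤ_[3]) ^ 3 + 3 * (-(β : ℤ_[3]) ^ 3 + β * β ^ 2 - 2 * γ * β + 3 * δ) := by rw [ha]; ring
    rw [e]
    simp only [map_add, map_mul, map_pow, map_neg, map_ofNat, show (3 : ZMod 3) = 0 from rfl, zero_mul,
      add_zero]
    exact neg_ne_zero.mpr (pow_ne_zero 3 hb)
  have hnorm : ‖F.aeval a‖ < ‖F.derivative.aeval a‖ ^ 2 := by rw [hF'a, one_pow]; exact hFa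
  obtain ⟨z, hz, -⟩ := hensels_lemma hnorm
  refine ⟨z, ?_⟩
  rw [hFeval] at hz
  linear_combination 3 * hz

end Local

/-! ### Global statements at a type `III` prime `3` (`9 ∥ N`, `v₃ Δ_min = 3`) -/

section Global

variable (W : WeierstrassCurve ℚ) [W.IsElliptic] [W.IsGloballyMinimal]

/-- **The Kummer discriminant of a LOCAL `3`-line is a `3`-adic unit**: for a `ℚ₃`-root `x` of `Ψ₃` on a global
minimal model of Kodaira type `III` at `3`, `|4x³ + b₂x² + 2b₄x + b₆|₃ = 1` (on the integer `III`-shape translate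
`x − r` is a `3`-adic unit `z` and the discriminant is `4z³ + 3βz² + 6γz + 9δ ≡ 4z³ (mod 3)`). -/
theorem tameThreeIII_norm_localDisc_eq_one (h9 : 3 ^ 2 ∣ W.conductorNorm ℤ) (h27 : ¬ 3 ^ 3 ∣ W.conductorNorm ℤ)
    (hΔ : padicValInt 3 W.minimalDiscriminantInt = 3) {x : ℚ_[3]} (hx : IsLocalThreeSubgroupX W x) :
    ‖4 * x ^ 3 + (W.b₂ : ℚ_[3]) * x ^ 2 + 2 * (W.b₄ : ℚ_[3]) * x + (W.b₆ : ℚ_[3])‖ = 1 := by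
  obtain ⟨r, β, γ, δ, ε, hε, e₂, e₄, e₆, e₈⟩ := exists_IIIShape_coeffs_three W h9 h27 hΔ
  unfold IsLocalThreeSubgroupX at hx
  rw [e₂, e₄, e₆, e₈] at hx
  push_cast at hx
  have hx' : 3 * (x - r) ^ 4 + 3 * (β : ℚ_[3]) * (x - r) ^ 3 + 9 * (γ : ℚ_[3]) * (x - r) ^ 2
      + 27 * (δ : ℚ_[3]) * (x - r) + 9 * (ε : ℚ_[3]) = 0 := by
    linear_combination hx
  have hn := norm_eq_one_of_psi3III_root hε hx'
  set z : ℤ_[3] := ⟨x - r, hn.le⟩ with hzdef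
  have hcz : (z : ℚ_[3]) = x - r := rfl
  have hu : IsUnit z := PadicInt.isUnit_iff.mpr hn
  have hD := isUnit_disc_of_isUnit (β := β) (γ := γ) (δ := δ) hu
  have e : (4 * x ^ 3 + (W.b₂ : ℚ_[3]) * x ^ 2 + 2 * (W.b₄ : ℚ_[3]) * x + (W.b₆ : ℚ_[3])) =
      ((4 * z ^ 3 + 3 * (β : ℤ_[3]) * z ^ 2 + 6 * (γ : ℤ_[3]) * z + 9 * (δ : ℤ_[3]) : ℤ_[3]) : ℚ_[3]) := by
    rw [e₂, e₄, e₆]; push_cast [hcz, coe_ofNat_three']; ring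
  rw [e, ← PadicInt.norm_def]
  exact PadicInt.isUnit_iff.mp hD

/-- **E-imc-77 `TameThreeIIICanonicalLineUnramified` (imc g14, MEMO-imc §20.4; HOME/imc/Sketch-imc-g14.lean :193–208),
datum-free form, PROVED**: on a global minimal model with `9 ∥ N` and `v₃ Δ_min = 3` (Kodaira type `III` at `3`),
at every `ℚ₃`-root `x` of `Ψ₃` — the abscissa of a `G_{ℚ₃}`-stable line of `E[3]` — the Kummer discriminant
`D₀ = 4x³ + b₂x² + 2b₄x + b₆` is non-zero with EVEN (indeed zero) `3`-adic valuation: the character `χ_{D₀}` of the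
canonical line is UNRAMIFIED at `3` (census g14-psi3.out 38 145 / 38 145, «ramified 0»).  The sketch's binder
`(_D : ModularParametrizationData W N)` is replaced by `W.conductorNorm ℤ` (refuter-1 T-54a: the datum pins `N` to
the conductor only through Carayol).  Local completion of E-imc-71 (`TypeThreeSubgroupCharacterUnramified_holds`).
Nothing about BSD or Manin's conjecture is proved here. [cite: SilvermanATAEC1994, IV.9.4 Steps 2–4 and Table 4.1] -/
theorem tameThreeIII_canonicalLine_unramified (h9 : 3 ^ 2 ∣ W.conductorNorm ℤ)
    (h27 : ¬ 3 ^ 3 ∣ W.conductorNorm ℤ) (hΔ : padicValInt 3 W.minimalDiscriminantInt = 3) (x : ℚ_[3])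
    (hx : 3 * x ^ 4 + (W.b₂ : ℚ_[3]) * x ^ 3 + 3 * (W.b₄ : ℚ_[3]) * x ^ 2 + 3 * (W.b₆ : ℚ_[3]) * x
      + (W.b₈ : ℚ_[3]) = 0) :
    4 * x ^ 3 + (W.b₂ : ℚ_[3]) * x ^ 2 + 2 * (W.b₄ : ℚ_[3]) * x + (W.b₆ : ℚ_[3]) ≠ 0 ∧
      Even (Padic.valuation
        (4 * x ^ 3 + (W.b₂ : ℚ_[3]) * x ^ 2 + 2 * (W.b₄ : ℚ_[3]) * x + (W.b₆ : ℚ_[3]))) := by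
  have h1 := tameThreeIII_norm_localDisc_eq_one W h9 h27 hΔ (x := x) hx
  have hne : 4 * x ^ 3 + (W.b₂ : ℚ_[3]) * x ^ 2 + 2 * (W.b₄ : ℚ_[3]) * x + (W.b₆ : ℚ_[3]) ≠ 0 := by
    intro h0; rw [h0, norm_zero] at h1; exact zero_ne_one h1
  refine ⟨hne, ?_⟩
  have hv := Padic.norm_eq_zpow_neg_valuation hne
  rw [h1, eq_comm, zpow_eq_one_iff_right₀ (by norm_num) (by norm_num), neg_eq_zero] at hv
  rw [hv]; exact Even.zero

/-- **E-imc-76 `TameThreeIIIShallowIffLocalLine` (imc g14, MEMO-imc §19.11 / §20; HOME/imc/Sketch-imc-g14.lean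
:184–191), datum-free form with `DeepIII` unfolded, PROVED**: on a global minimal model with `9 ∥ N` and
`v₃ Δ_min = 3` (type `III` at `3`), `Ψ₃` has a root in `ℚ₃` (`E[3]` has a `G_{ℚ₃}`-stable line) iff the curve is
SHALLOW, `¬ (b₂ − 12b₆ = 0 ∨ 2 ≤ v₃(b₂ − 12b₆))` (`9 ∤ b₂ − 12b₆`; census shallow 38 145 / deep 17 577, g14-psi3.out).
Proof: on the integer `III`-shape translate `b₂ − 12b₆ ≡ 3β (mod 9)`; a unit root is `≡ −β (mod 3)` so forces
`3 ∤ β`, and conversely for `3 ∤ β` the simple root `−β` of `z⁴ + βz³ (mod 3)` lifts by Hensel's lemma.  The datum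
binder of the sketch is replaced by `W.conductorNorm ℤ` (refuter-1 T-54a).  Nothing about BSD or Manin's conjecture
is proved here. [cite: SilvermanATAEC1994, IV.9.4 Steps 2–4 and Table 4.1] -/
theorem tameThreeIII_localLine_iff_shallow (h9 : 3 ^ 2 ∣ W.conductorNorm ℤ) (h27 : ¬ 3 ^ 3 ∣ W.conductorNorm ℤ)
    (hΔ : padicValInt 3 W.minimalDiscriminantInt = 3) :
    ¬ NoLocalThreeLineAtThree W ↔ ¬ (W.b₂ - 12 * W.b₆ = 0 ∨ 2 ≤ padicValRat 3 (W.b₂ - 12 * W.b₆)) := by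
  obtain ⟨r, β, γ, δ, ε, hε, e₂, e₄, e₆, e₈⟩ := exists_IIIShape_coeffs_three W h9 h27 hΔ
  -- `b₂ − 12 b₆ = 3β + 9K`
  obtain ⟨m, hm⟩ : (3 : ℤ) ∣ r ^ 3 - r := by
    have key : ∀ a : ZMod 3, a ^ 3 - a = 0 := by decide
    exact (ZMod.intCast_zmod_eq_zero_iff_dvd _ 3).mp (by push_cast; exact key _)
  set K : ℤ := 16 * m + 4 * r - 12 * δ + 8 * γ * r - 4 * β * r ^ 2 with hK
  have hQ : W.b₂ - 12 * W.b₆ = ((3 * β + 9 * K : ℤ) : ℚ) := by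
    rw [e₂, e₆, hK]; push_cast
    have hm' : ((r : ℤ) : ℚ) ^ 3 - r = 3 * m := by exact_mod_cast hm
    linear_combination (48 : ℚ) * hm'
  -- the right-hand side says `3 ∣ β`
  have hR : (W.b₂ - 12 * W.b₆ = 0 ∨ 2 ≤ padicValRat 3 (W.b₂ - 12 * W.b₆)) ↔ (3 : ℤ) ∣ β := by
    rw [hQ, Int.cast_eq_zero, padicValRat.of_int]
    have e9 : ((3 : ℕ) : ℤ) ^ 2 ∣ 3 * β + 9 * K ↔ (3 : ℤ) ∣ β := by
      constructor
      · rintro ⟨t, ht⟩; norm_num at ht; exact ⟨t - K, by omega⟩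
      · rintro ⟨b, hb⟩; exact ⟨b + K, by rw [hb]; push_cast; ring⟩
    rw [← e9, padicValInt_dvd_iff]
    norm_cast
  -- the left-hand side says `3 ∤ β`
  have hL : ¬ NoLocalThreeLineAtThree W ↔ ¬ (3 : ℤ) ∣ β := by
    rw [noLocalThreeLineAtThree_iff, not_forall]
    constructor
    · rintro ⟨x, hx⟩
      rw [not_not] at hx
      unfold IsLocalThreeSubgroupX at hx
      rw [e₂, e₄, e₆, e₈] at hx
      push_cast at hx
      have hx' : 3 * (x - r) ^ 4 + 3 * (β : ℚ_[3]) * (x - r) ^ 3 + 9 * (γ : ℚ_[3]) * (x - r) ^ 2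
          + 27 * (δ : ℚ_[3]) * (x - r) + 9 * (ε : ℚ_[3]) = 0 := by
        linear_combination hx
      have hn := norm_eq_one_of_psi3III_root hε hx'
      set z : ℤ_[3] := ⟨x - r, hn.le⟩ with hzdef
      have hcz : (z : ℚ_[3]) = x - r := rfl
      have hu : IsUnit z := PadicInt.isUnit_iff.mpr hn
      have hz : 3 * z ^ 4 + 3 * (β : ℤ_[3]) * z ^ 3 + 9 * (γ : ℤ_[3]) * z ^ 2 + 27 * (δ : ℤ_[3]) * z
          + 9 * (ε : ℤ_[3]) = 0 := by
        rw [← PadicInt.coe_eq_zero]; push_cast [hcz]; exact hx'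
      exact not_three_dvd_of_psi3III_root hu hz
    · intro hβ
      obtain ⟨z, hz⟩ := exists_psi3III_root_of_not_three_dvd (γ := γ) (δ := δ) (ε := ε) hβ
      refine ⟨(z : ℚ_[3]) + r, not_not.mpr ?_⟩
      unfold IsLocalThreeSubgroupX
      rw [e₂, e₄, e₆, e₈]
      push_cast
      have hz' : ((3 * z ^ 4 + 3 * (β : ℤ_[3]) * z ^ 3 + 9 * (γ : ℤ_[3]) * z ^ 2 + 27 * (δ : ℤ_[3]) * z
          + 9 * (ε : ℤ_[3]) : ℤ_[3]) : ℚ_[3]) = 0 := by rw [hz, PadicInt.coe_zero]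
      push_cast [coe_ofNat_three'] at hz'
      linear_combination hz'
  rw [hL, hR]

end Global

end Summit.BirchSwinnertonDyer.BirchSwinnertonDyer.Theorems.ManinLocalTwoThree

end
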